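import Mathlib
import Literature.MathematicalPhysics.QuantumFieldTheory.Balaban1983to89.B11Eq174Chart

/-!
# `Balaban1983to89.B11Eq177SecondOrder` — T. Bałaban, *The variational problem and background fields in renormalization group method for
# lattice gauge theories*, Commun. Math. Phys. **102** (1985) 277–309 [Balaban1985Variational], p. 306, display (177): the printed FIRST
# AND SECOND ORDER TERMS of the chart 𝓗 = 𝒜₁ + H₁B − HD(𝒜₁ + H₁B) DERIVED in norm form at the Sect. E–G scheme level

statement-level skeleton of published theorems with citation tags; proofs where landed; nothing here is a claim about the Yang–Mills mass gap

PDF held: `paper:balaban1985-cmp102-variational-background` (journal page = PDF page + 276); p. 306 [PDF 30] read by this seat from the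
`lit read` text layer (2026-08-21); the display (177) as transcribed in `B11Eq176Expansion` (its docstring: *«(177) is then (174) read to
second order; the term −HC⁽²⁾(H₁B) comes from D⁽²⁾ = C⁽²⁾ ((56)) and is not re-derived here»* — it is derived HERE).

CITATION HEADER (lean-in-tree rule 2026-08-18).  WHAT IS REPRODUCED: SKELETON row **B11.Eq174** (reader r08 `ROWS-B11.md`; decls of
record `B11.AnData.HDet`, `B11Prop6Scheme.solution_analytic`, `B11Eq176Expansion.*`, `B11Eq174Chart.*`), the sentence p. 306 [PDF 30],
verbatim: *«Let us notice that it begins with a term of second order in H₁B, more exactly we have 𝒜₁⁽²⁾ = −𝔊((δ/δA′)V⁽³⁾)(H₁B). (176) This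
implies that the expansion of 𝓗 begins with the first order term H₁B. Let us write first and second order terms in it
𝓗 = H₁B − 𝔊((δ/δA′)V⁽³⁾)(H₁B) − HC⁽²⁾(H₁B) + ⋯. (177) We can generate this way terms of an arbitrary order in the expansion.»*
Context: 𝓗 = 𝒜₁ + H₁B − HD(𝒜₁ + H₁B) (174) = `B11Eq174Chart.chartH 𝒢 0 W 0 T ε₄ 𝔄` with `T Y = Y − H(D(Y))` the Sect. C map (47) and
`𝔄 = H₁B`; 𝒜₁ = `solA 𝒢 0 W 0 ε₄ 𝔄` solves (175); «D⁽²⁾(A′) = C⁽²⁾(LʲηA′)» is (56) p. 286.  The tree had: (176) as the third-order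
agreement `‖𝒜₁ + 𝒢(W₂𝔄)‖ ≤ 4B₀²C₄²(ε₄ + a)³ + B₀C′a³` (`B11Eq176Expansion.norm_solution_add_quadratic_le`), the second-order size
`‖𝒜₁‖ ≤ B₀C₄(ε₄ + a)²` (`B11Eq174Chart.Regime.norm_solA_le_sq`), and (177)'s FIRST member only (`Regime.norm_chartH_sub_le`,
`Regime.norm_chartH_sub_self_le`: ‖𝓗 − T𝔄‖, ‖𝓗 − 𝔄‖ of second order).

WHAT IS CERTIFIED (kernel, sorry-free; axioms standard).  Over complex Banach spaces `𝒴` (the space of (115)), `𝒵` (𝔊's source), `𝒲`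
(the values of `D`), data `𝒢 : 𝒵 →L[ℂ] 𝒴`, `W : 𝒴 → 𝒵`, a `B11Eq174Chart.Regime 𝒢 0 W B₀ θ C₄ a₃ j a ε₄`, `‖𝔄‖ < a`, and LETTERS:
`hW₂ : ‖W Y − W₂ Y‖ ≤ C′‖Y‖³` on `‖Y‖ < a₃` (`W₂ = (δ/δA′)V⁽³⁾`, as in `B11Eq176Expansion`), `hD₂ : ‖D Y − C₂ Y‖ ≤ K₃‖Y‖³` on
`‖Y‖ < ε₄ + a` (D = C⁽²⁾ + O(3): (55)–(56); `norm_sub_quadratic_le_of_steps` assembles it from `D = C + O(3)` — `B12Lineariz267`, 36C₂²b —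
and `C = C⁽²⁾ + O(3)` — [4] (135)–(136), `B11Eq44Concrete.norm_Cmap_sub_C2map_le`), `hC₂ : ‖C₂Y₁ − C₂Y₂‖ ≤ c₂(‖Y₁‖ + ‖Y₂‖)‖Y₁ − Y₂‖`
(DERIVED for a bounded bilinear `C2`, `norm_quadratic_sub_le`, c₂ = ‖C2‖):
**`norm_chartH_sub_secondOrder_le`** — `‖𝓗 − (𝔄 − 𝒢(W₂𝔄) − H(C₂𝔄))‖ ≤ (4B₀²C₄² + ‖H‖(K₃ + 2c₂B₀C₄))(ε₄ + a)³ + B₀C′a³`, i.e. the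
chart agrees with the printed `H₁B − 𝔊((δ/δA′)V⁽³⁾)(H₁B) − HC⁽²⁾(H₁B)` to THIRD order; `norm_chartH_sub_secondOrder_le_bilinear` (the same
with the printed bilinear C⁽²⁾).  Mechanism (three lines of print's «solving a recursive system of equations», to order two):
𝓗 − (𝔄 − 𝒢W₂𝔄 − HC₂𝔄) = (𝒜₁ + 𝒢W₂𝔄) − H(D(Y) − C₂(Y)) − H(C₂(Y) − C₂(𝔄)), Y = 𝒜₁ + 𝔄, the three terms being O((ε₄ + a)³) by
(176), by `hD₂`, and by `hC₂` with ‖Y − 𝔄‖ = ‖𝒜₁‖ ≤ B₀C₄(ε₄ + a)².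

HONEST SCOPE — what is NOT claimed.  «terms of an arbitrary order» (the full recursive expansion) is not typed — only orders ≤ 2 with a
third-order remainder, in the (ε₄ + a)-calculus of `B11Eq176Expansion` (the chart does not depend on the auxiliary radius ε₄,
`Regime.chartH_eq_of_le`, so ε₄ may be taken comparable to a²); the identification `W₂ = (δ/δA′)V⁽³⁾` and the lattice objects 𝔊, H, D,
C⁽²⁾ of [4], [5] are letters, as in the files this one sits on.  No definition, no new named fact: theorems over hypothesis binders.
Mega-formalization `lit-balaban`, HOME `run/shared/lean/pub/lit-balaban/`, reader/typer seat r08 gen 9 (unit `lit-balaban-r08`, B11 fold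
owner).  Imports `B11Eq174Chart` (hence `B11Eq176Expansion`, `B11Prop6Scheme`); modifies nothing there.
-/

namespace Literature.MathematicalPhysics.QuantumFieldTheory.Balaban1983to89.B11Eq177SecondOrder

open Metric Set
open Literature.MathematicalPhysics.QuantumFieldTheory.Balaban1983to89
open B11Prop6Scheme B11Eq176Expansion B11Eq174Chart

variable {𝒴 𝒵 𝒲 : Type*} [NormedAddCommGroup 𝒴] [NormedSpace ℂ 𝒴] [NormedAddCommGroup 𝒵] [NormedSpace ℂ 𝒵]
  [NormedAddCommGroup 𝒲] [NormedSpace ℂ 𝒲]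
  {𝒢 : 𝒵 →L[ℂ] 𝒴} {W : 𝒴 → 𝒵} {B₀ θ C₄ a₃ j a ε₄ : ℝ} {𝔄 : 𝒴}

omit [NormedSpace ℂ 𝒴] [NormedSpace ℂ 𝒲] in
/-- «D⁽²⁾(A′) = C⁽²⁾(LʲηA′)» ((56)) assembled from the two third-order agreements `D = C + O(3)` ((55)–(56),
`B12Lineariz267`) and `C = C⁽²⁾ + O(3)` ([4] (135)–(136), `B11Eq44Concrete.norm_Cmap_sub_C2map_le`): `D = C⁽²⁾ + O(3)` on the ball.
[cite: Balaban1985Variational, (55)–(56) p.286] -/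
theorem norm_sub_quadratic_le_of_steps {D C C₂ : 𝒴 → 𝒲} {K₁ K₂ m : ℝ}
    (h₁ : ∀ Y : 𝒴, ‖Y‖ < m → ‖D Y - C Y‖ ≤ K₁ * ‖Y‖ ^ 3) (h₂ : ∀ Y : 𝒴, ‖Y‖ < m → ‖C Y - C₂ Y‖ ≤ K₂ * ‖Y‖ ^ 3)
    (Y : 𝒴) (hY : ‖Y‖ < m) : ‖D Y - C₂ Y‖ ≤ (K₁ + K₂) * ‖Y‖ ^ 3 := by
  have e : D Y - C₂ Y = (D Y - C Y) + (C Y - C₂ Y) := by abel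
  rw [e, add_mul]
  exact (norm_add_le _ _).trans (add_le_add (h₁ Y hY) (h₂ Y hY))

variable [CompleteSpace 𝒴]

/-- **(177), the printed first AND second order terms** (p. 306 [30], verbatim: *«This implies that the expansion of 𝓗 begins with the
first order term H₁B. Let us write first and second order terms in it 𝓗 = H₁B − 𝔊((δ/δA′)V⁽³⁾)(H₁B) − HC⁽²⁾(H₁B) + ⋯. (177)»*), in
NORM FORM at the Sect. E–G scheme level: for the chart `𝓗 = T(𝒜₁ + 𝔄)` ((174), `B11Eq174Chart.chartH`, `Λ = 0`, `J = 0`) with the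
Sect. C map `T Y = Y − H(D(Y))` ((47)), where on the ball `‖Y‖ < ε₄ + a` the function `D` agrees with the quadratic map `C₂`
(= `C⁽²⁾(Lʲη·)`, (56)) to third order (`‖D Y − C₂ Y‖ ≤ K₃‖Y‖³`) and `C₂` is Lipschitz with constant `c₂(‖Y₁‖ + ‖Y₂‖)` (polarisation of a
bounded quadratic form, [4] (138)), and `W = (δ/δA′)V` agrees with its quadratic part `W₂ = (δ/δA′)V⁽³⁾` to third order on `‖Y‖ < a₃`
(`‖W Y − W₂ Y‖ ≤ C′‖Y‖³`, as in `B11Eq176Expansion.norm_solution_add_quadratic_le`):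
`‖𝓗 − (𝔄 − 𝒢(W₂𝔄) − H(C₂𝔄))‖ ≤ (4B₀²C₄² + ‖H‖(K₃ + 2c₂B₀C₄))(ε₄ + a)³ + B₀C′a³` — the chart agrees with
`H₁B − 𝔊((δ/δA′)V⁽³⁾)(H₁B) − HC⁽²⁾(H₁B)` to THIRD order (the (176) agreement `B11Eq176Expansion.norm_solution_add_quadratic_le` + the
second-order size of 𝒜₁ `B11Eq174Chart.Regime.norm_solA_le_sq`, BY NAME). [cite: Balaban1985Variational, (177) p.306, (176) p.306, (56) p.286] -/
theorem norm_chartH_sub_secondOrder_le (R : Regime 𝒢 0 W B₀ θ C₄ a₃ j a ε₄) (hj : 0 ≤ j) (h𝔄 : ‖𝔄‖ < a)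
    {W₂ : 𝒴 → 𝒵} {C' : ℝ} (hC' : 0 ≤ C') (hW₂ : ∀ Y : 𝒴, ‖Y‖ < a₃ → ‖W Y - W₂ Y‖ ≤ C' * ‖Y‖ ^ 3)
    (H : 𝒲 →L[ℂ] 𝒴) {D C₂ : 𝒴 → 𝒲} {K₃ c₂ : ℝ} (hK₃ : 0 ≤ K₃) (hc₂ : 0 ≤ c₂)
    (hD₂ : ∀ Y : 𝒴, ‖Y‖ < ε₄ + a → ‖D Y - C₂ Y‖ ≤ K₃ * ‖Y‖ ^ 3)
    (hC₂ : ∀ Y₁ Y₂ : 𝒴, ‖Y₁‖ < ε₄ + a → ‖Y₂‖ < ε₄ + a → ‖C₂ Y₁ - C₂ Y₂‖ ≤ c₂ * (‖Y₁‖ + ‖Y₂‖) * ‖Y₁ - Y₂‖) :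
    ‖chartH 𝒢 0 W 0 (fun Y : 𝒴 => Y - H (D Y)) ε₄ 𝔄 - (𝔄 - 𝒢 (W₂ 𝔄) - H (C₂ 𝔄))‖ ≤
      (4 * B₀ ^ 2 * C₄ ^ 2 + ‖H‖ * (K₃ + 2 * c₂ * B₀ * C₄)) * (ε₄ + a) ^ 3 + B₀ * C' * a ^ 3 := by
  have hm := R.solA_mem (J := 0) (by simpa using hj) h𝔄
  set X : 𝒴 := solA 𝒢 0 W 0 ε₄ 𝔄 with hX
  set m : ℝ := ε₄ + a with hmdef
  have hXm : ‖X + 𝔄‖ < m := norm_arg_lt h𝔄 hm.1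
  have hmpos : 0 < m := (norm_nonneg _).trans_lt hXm
  have h𝔄m : ‖𝔄‖ < m := by
    have := R.ε₄_nonneg
    rw [hmdef]; linarith
  have hsq : ‖X‖ ≤ B₀ * C₄ * m ^ 2 := R.norm_solA_le_sq hj h𝔄
  have h176 : ‖X + 𝒢 (W₂ 𝔄)‖ ≤ 4 * B₀ ^ 2 * C₄ ^ 2 * m ^ 3 + B₀ * C' * a ^ 3 :=
    norm_solution_add_quadratic_le R.norm_G R.quad R.B₀_nonneg R.C₄_nonneg hC' hW₂ h𝔄 R.ε₄_nonneg R.dom hm.1 hm.2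
  -- the two `H`-terms
  have hH1 : ‖H (D (X + 𝔄) - C₂ (X + 𝔄))‖ ≤ ‖H‖ * (K₃ * m ^ 3) := by
    refine (H.le_opNorm _).trans (mul_le_mul_of_nonneg_left ?_ (norm_nonneg _))
    exact (hD₂ _ hXm).trans (mul_le_mul_of_nonneg_left (pow_le_pow_left₀ (norm_nonneg _) hXm.le 3) hK₃)
  have hH2 : ‖H (C₂ (X + 𝔄) - C₂ 𝔄)‖ ≤ ‖H‖ * (2 * c₂ * B₀ * C₄ * m ^ 3) := by
    refine (H.le_opNorm _).trans (mul_le_mul_of_nonneg_left ?_ (norm_nonneg _))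
    have h1 := hC₂ _ _ hXm h𝔄m
    rw [add_sub_cancel_right] at h1
    refine h1.trans ?_
    have h2 : ‖X + 𝔄‖ + ‖𝔄‖ ≤ 2 * m := by linarith [hXm.le, h𝔄m.le]
    calc c₂ * (‖X + 𝔄‖ + ‖𝔄‖) * ‖X‖ ≤ c₂ * (2 * m) * (B₀ * C₄ * m ^ 2) := by
          gcongr
      _ = 2 * c₂ * B₀ * C₄ * m ^ 3 := by ring
  have e : chartH 𝒢 0 W 0 (fun Y : 𝒴 => Y - H (D Y)) ε₄ 𝔄 - (𝔄 - 𝒢 (W₂ 𝔄) - H (C₂ 𝔄)) =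
      (X + 𝒢 (W₂ 𝔄)) - H (D (X + 𝔄) - C₂ (X + 𝔄)) - H (C₂ (X + 𝔄) - C₂ 𝔄) := by
    rw [chartH_def, map_sub, map_sub]
    abel
  rw [e]
  calc ‖(X + 𝒢 (W₂ 𝔄)) - H (D (X + 𝔄) - C₂ (X + 𝔄)) - H (C₂ (X + 𝔄) - C₂ 𝔄)‖
      ≤ ‖X + 𝒢 (W₂ 𝔄)‖ + ‖H (D (X + 𝔄) - C₂ (X + 𝔄))‖ + ‖H (C₂ (X + 𝔄) - C₂ 𝔄)‖ := norm_sub_le_of_le (norm_sub_le _ _) le_rfl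
    _ ≤ (4 * B₀ ^ 2 * C₄ ^ 2 * m ^ 3 + B₀ * C' * a ^ 3) + ‖H‖ * (K₃ * m ^ 3) + ‖H‖ * (2 * c₂ * B₀ * C₄ * m ^ 3) :=
        add_le_add (add_le_add h176 hH1) hH2
    _ = (4 * B₀ ^ 2 * C₄ ^ 2 + ‖H‖ * (K₃ + 2 * c₂ * B₀ * C₄)) * m ^ 3 + B₀ * C' * a ^ 3 := by ring

omit [CompleteSpace 𝒴] in
/-- The Lipschitz letter for a quadratic map DERIVED: for a bounded bilinear `C2` ((138) of [4]: C⁽²⁾ is a bounded symmetric bilinear form in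
A′), the quadratic map `Y ↦ C2 Y Y` satisfies `‖C2 Y₁ Y₁ − C2 Y₂ Y₂‖ ≤ ‖C2‖(‖Y₁‖ + ‖Y₂‖)‖Y₁ − Y₂‖` (polarisation).
[cite: Balaban1985Variational, (56) p.286; Balaban1985Averaging, (138) p.39] -/
theorem norm_quadratic_sub_le (C2 : 𝒴 →L[ℂ] 𝒴 →L[ℂ] 𝒲) (Y₁ Y₂ : 𝒴) :
    ‖C2 Y₁ Y₁ - C2 Y₂ Y₂‖ ≤ ‖C2‖ * (‖Y₁‖ + ‖Y₂‖) * ‖Y₁ - Y₂‖ := by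
  have e : C2 Y₁ Y₁ - C2 Y₂ Y₂ = C2 (Y₁ - Y₂) Y₁ + C2 Y₂ (Y₁ - Y₂) := by
    simp only [map_sub, sub_apply]; abel
  rw [e]
  have h1 : ‖C2 (Y₁ - Y₂) Y₁‖ ≤ ‖C2‖ * ‖Y₁ - Y₂‖ * ‖Y₁‖ := C2.le_opNorm₂ _ _
  have h2 : ‖C2 Y₂ (Y₁ - Y₂)‖ ≤ ‖C2‖ * ‖Y₂‖ * ‖Y₁ - Y₂‖ := C2.le_opNorm₂ _ _
  calc ‖C2 (Y₁ - Y₂) Y₁ + C2 Y₂ (Y₁ - Y₂)‖ ≤ ‖C2‖ * ‖Y₁ - Y₂‖ * ‖Y₁‖ + ‖C2‖ * ‖Y₂‖ * ‖Y₁ - Y₂‖ :=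
        (norm_add_le _ _).trans (add_le_add h1 h2)
    _ = ‖C2‖ * (‖Y₁‖ + ‖Y₂‖) * ‖Y₁ - Y₂‖ := by ring

/-- **(177) with the printed bilinear `C⁽²⁾`**: the same third-order agreement for `T Y = Y − H(D(Y))` with `‖D Y − C2 Y Y‖ ≤ K₃‖Y‖³` on the
ball and `C2` a bounded bilinear map (constant `c₂ = ‖C2‖`). [cite: Balaban1985Variational, (177) p.306, (56) p.286] -/
theorem norm_chartH_sub_secondOrder_le_bilinear (R : Regime 𝒢 0 W B₀ θ C₄ a₃ j a ε₄) (hj : 0 ≤ j) (h𝔄 : ‖𝔄‖ < a)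
    {W₂ : 𝒴 → 𝒵} {C' : ℝ} (hC' : 0 ≤ C') (hW₂ : ∀ Y : 𝒴, ‖Y‖ < a₃ → ‖W Y - W₂ Y‖ ≤ C' * ‖Y‖ ^ 3)
    (H : 𝒲 →L[ℂ] 𝒴) {D : 𝒴 → 𝒲} (C2 : 𝒴 →L[ℂ] 𝒴 →L[ℂ] 𝒲) {K₃ : ℝ} (hK₃ : 0 ≤ K₃)
    (hD₂ : ∀ Y : 𝒴, ‖Y‖ < ε₄ + a → ‖D Y - C2 Y Y‖ ≤ K₃ * ‖Y‖ ^ 3) :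
    ‖chartH 𝒢 0 W 0 (fun Y : 𝒴 => Y - H (D Y)) ε₄ 𝔄 - (𝔄 - 𝒢 (W₂ 𝔄) - H (C2 𝔄 𝔄))‖ ≤
      (4 * B₀ ^ 2 * C₄ ^ 2 + ‖H‖ * (K₃ + 2 * ‖C2‖ * B₀ * C₄)) * (ε₄ + a) ^ 3 + B₀ * C' * a ^ 3 :=
  norm_chartH_sub_secondOrder_le R hj h𝔄 hC' hW₂ H (C₂ := fun Y : 𝒴 => C2 Y Y) hK₃ (norm_nonneg C2) hD₂
    (fun Y₁ Y₂ _ _ => norm_quadratic_sub_le C2 Y₁ Y₂)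

end Literature.MathematicalPhysics.QuantumFieldTheory.Balaban1983to89.B11Eq177SecondOrder
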